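import Summits.AtomisticToContinuum.FouriersLaw.Theses.CageBudgetFekete

/-!
# BC3 birth skeleton — crux `QuasiSuperadditiveHeatVariance` (stmt-AtomisticToContinuum-15769) of route CageBudgetFekete

Crux (route decl `Summit.AtomisticToContinuum.FouriersLaw.Theses.CageBudgetFekete.QuasiSuperadditiveHeatVariance`):
for `pinnedChain ω₂ lam β γ` (`ω₂, lam, β > 0`), every `T > 0` and every guarded pair (`μ` a shift- and
momentum-reversal-invariant Gibbs state at `T`, `D` a `μ`-preserving shift-covariant `InfiniteChainDynamics`) with
absolutely convergent, continuous summed current autocorrelation `C(t) = D.currentCorrelation μ t`, the heat variance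
`V(τ) = 2∫_{(0,τ]} (τ−s) C(s) ds` is superadditive up to a bounded defect:
`∃ K ≥ 0, ∀ s t ≥ 0, V s + V t ≤ V (s+t) + K`.

## The line (two stubs): CAGE BUDGET = FIRST MOMENT OF THE NEGATIVE MEMORY

The adjacent-window covariance identity (Einstein–Helfand bookkeeping, Helfand1960; Gaspard2022 §3.2.9
(3.116)–(3.117)): for `s, t ≥ 0`,
`V(s+t) − V(s) − V(t) = 2 ∫_{(0,s+t]} m_{s,t}(w) C(w) dw`, `m_{s,t}(w) = (s+t−w) − (s−w)⁺ − (t−w)⁺`,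
a trapezoid with `0 ≤ m_{s,t}(w) ≤ min(w, s, t, s+t−w)`.  Hence
`V(s) + V(t) − V(s+t) = −2∫ m C ≤ 2∫ m · C⁻ ≤ 2 ∫_{(0,s+t]} w · C⁻(w) dw` with `C⁻ = max(−C, 0)`:
the anticorrelation of heat increments over adjacent windows is controlled by the RUNNING FIRST MOMENT OF THE
NEGATIVE PART OF THE MEMORY, uniformly in the window lengths.  So:

* `stub_windowCovarianceBound` — the real-analysis half (true for EVERY continuous `C : ℝ → ℝ`; provable now,
  M-sized in Lean: split `∫_{(0,s+t]}` at `s` and at `t`, pointwise trapezoid bounds, `setIntegral_mono_on` with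
  integrability from continuity on a bounded interval): `V s + V t ≤ V (s+t) + 2 ∫_{(0,s+t]} w · max(−C w, 0) dw`.
* `stub_negativeMemoryMoment` — the physical half, the route's bet (route header WHY THIS LINE: "K_T :=
  2∫₀^∞ w·C_T(w)⁻ dw is a uniform cage budget"; TWO-LAYER PLAN node `NegativeMemoryMoment`): in the crux's arena,
  `∃ K₀, ∀ R ≥ 0, ∫_{(0,R]} w · max(−C_T(w), 0) dw ≤ K₀`, i.e. `t · C_T⁻ ∈ L¹(0,∞)` (equivalent formulation for the
  nonnegative continuous integrand, by monotone convergence).  Mechanism per the route: `K₀ = 0` at the harmonic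
  member (`C ≡ C(0) > 0`) and in the kinetic corner (`C_kin = ⟨h, e^{−|t|L̃} h⟩` completely monotone,
  AokiLukkarinenSpohn2006 (3.25), LukkarinenSpohn2008 Prop 2.4); in the hot window `K₀ ≈` first moment of the Born
  cage lobe; at generic `T` the TOTAL current of a one-component 1-D chain has no one-mode hydrodynamic tail.  Why it
  might fail (route): a negative algebraic tail `−t^(−a)`, `a ≤ 2`, of the summed-current memory.

Assembly (sorry-free): `K := 2 · max K₀ 0`; for `s, t ≥ 0` chain the window bound with the moment bound at
`R := s + t`.  The skeleton theorem `QuasiSuperadditiveHeatVariance_of : Registered.stub_windowCovarianceBound →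
Registered.stub_negativeMemoryMoment → CageBudgetFekete.QuasiSuperadditiveHeatVariance` concludes the crux BY NAME
(`Registered.stub_x := type_of% stub_x` is definitionally the statement of the sorried stub), and
`QuasiSuperadditiveHeatVariance_of_stubs : CageBudgetFekete.QuasiSuperadditiveHeatVariance :=
QuasiSuperadditiveHeatVariance_of stub_windowCovarianceBound stub_negativeMemoryMoment` instantiates it.

Why not a costume / not shredded: neither stub mentions `V s + V t ≤ V (s+t) + K` with a UNIFORM `K`;
`stub_windowCovarianceBound` alone leaves the running moment unbounded (it holds for `C(w) = −1`, where
`V(s)+V(t)−V(s+t) = 2st` is unbounded), `stub_negativeMemoryMoment` alone says nothing about `V`; neither is implied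
by the crux (the crux does not force `t·C⁻ ∈ L¹`: oscillating memories cancel), and neither touches the NESS /
`FouriersLaw`.  BC3 probes (planner folder `bc/stub{W,M}_probe_{crux,summit}.lean`, `first | exact? | simpa | aesop`
in implication and hypothesis form) all FAIL; control probe (crux definiens as hypothesis → crux) succeeds.

Disproof used: none exists for this crux (`ledger crux ls stmt-AtomisticToContinuum-15769`: no workfiles before this
file; no `Disproof.lean`, no `Theorems/QuasiSuperadditiveHeatVariance/Negative/`).  `ledger negatives --problem
AtomisticToContinuum` (20 entries; FouriersLaw: `not_OddCorrectorDecay`, `DiluteCellGaussianiserFarFieldGaussianity_refuted`)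
— neither concerns current autocorrelations of the infinite closed chain; no stub is an instance they refute.
Refuter route-review (evidence REVIEW-CageBudgetFekete.md, 2026-08-16): "Q ⇔ essentially ∫ w·C_T⁻ < ∞ (exact kernel
identity)" — this skeleton is exactly that reading, with the kernel identity isolated as the provable stub.
-/

namespace Summit.AtomisticToContinuum.FouriersLaw.Cruxes.QuasiSuperadditiveHeatVariance.Birth

open MeasureTheory Set Filter Topology
open Literature.MathematicalPhysics.KineticTheory.HeatConduction

/-- STUB W — ADJACENT-WINDOW COVARIANCE BOUND (Einstein–Helfand calculus; pure real analysis).  For every continuous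
memory `C : ℝ → ℝ` and `V(τ) = 2∫_{(0,τ]} (τ−s) C(s) ds`: for all `s, t ≥ 0`,
`V s + V t ≤ V (s+t) + 2 ∫_{(0,s+t]} w · max(−C(w), 0) dw`.
Proof sketch: `V(s)+V(t)−V(s+t) = −2∫_{(0,s+t]} m_{s,t} C` with the trapezoid
`m_{s,t}(w) = (s+t−w) − (s−w)⁺ − (t−w)⁺ ∈ [0, w]`, then `−m C ≤ m C⁻ ≤ w C⁻` pointwise and monotonicity of the
integral (all integrands continuous on the bounded interval, hence integrable). [cite: Helfand1960; Gaspard2022 §3.2.9 (3.116)–(3.117)] -/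
theorem stub_windowCovarianceBound :
    ∀ C : ℝ → ℝ, Continuous C → ∀ V : ℝ → ℝ,
      V = (fun τ : ℝ => 2 * ∫ s in Set.Ioc (0:ℝ) τ, (τ - s) * C s) →
    ∀ s t : ℝ, 0 ≤ s → 0 ≤ t →
      V s + V t ≤ V (s + t) + 2 * ∫ w in Set.Ioc (0:ℝ) (s + t), w * max (-(C w)) 0 := by
  sorry

/-- STUB M — FINITE FIRST MOMENT OF THE NEGATIVE MEMORY (the physical half; the route's cage budget
`K_T = 2∫₀^∞ w·C_T(w)⁻ dw`).  In the crux's arena — `pinnedChain ω₂ lam β γ` (`ω₂, lam, β > 0`), `T > 0`, `μ` a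
shift- and momentum-reversal-invariant Gibbs state at `T`, `D` a `μ`-preserving shift-covariant infinite-volume
dynamics with absolutely convergent, continuous `C_T(t) = D.currentCorrelation μ t` — the running first moment of the
negative part of the memory is bounded: `∃ K₀, ∀ R ≥ 0, ∫_{(0,R]} w · max(−C_T(w), 0) dw ≤ K₀`
(equivalently `t·C_T⁻ ∈ L¹(0,∞)`).  `K₀ = 0` wherever `C_T ≥ 0` (harmonic member; kinetic corner, where the
limiting memory is completely monotone); the bet is a finite first moment of the Born cage lobe in the hot window and
no negative algebraic tail `−t^(−a)`, `a ≤ 2`, of the SUMMED current at any admissible `T`.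
[cite: AokiLukkarinenSpohn2006 (3.25); LukkarinenSpohn2008 Prop 2.4; DeRoeckHuveneers2015 Thm 1 (the delimiter)] -/
theorem stub_negativeMemoryMoment :
    ∀ ω₂ lam β γ : ℝ, 0 < ω₂ → 0 < lam → 0 < β → ∀ T : ℝ, 0 < T →
    ∀ μ : Measure ChainConfig, (pinnedChain ω₂ lam β γ).IsChainGibbsMeasure T μ →
      IsShiftInvariant μ →
      μ.map (fun σ : ChainConfig => fun x : ℤ => ((σ x).1, -(σ x).2)) = μ →
    ∀ D : InfiniteChainDynamics (pinnedChain ω₂ lam β γ), D.PreservesMeasure μ →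
      (∀ t : ℝ, ∀ᵐ σ ∂μ, D.flow t (shift σ) = shift (D.flow t σ)) →
      (∀ t : ℝ, D.HasAbsConvergentCorrelation μ t) →
      Continuous (fun t : ℝ => D.currentCorrelation μ t) →
    ∃ K₀ : ℝ, ∀ R : ℝ, 0 ≤ R →
      ∫ w in Set.Ioc (0:ℝ) R, w * max (-(D.currentCorrelation μ w)) 0 ≤ K₀ := by
  sorry

/-! ### By-name statements of the registered stubs

`Registered.stub_x` is DEFINITIONALLY the statement of the sorried `theorem stub_x` (`type_of%`), so
`QuasiSuperadditiveHeatVariance_of : Registered.stub_windowCovarianceBound → Registered.stub_negativeMemoryMoment →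
QuasiSuperadditiveHeatVariance` is literally "stub signatures → crux". -/

namespace Registered

/-- Statement of registered stub W (`stub_windowCovarianceBound`), by name. -/
def stub_windowCovarianceBound : Prop := type_of% Birth.stub_windowCovarianceBound

/-- Statement of registered stub M (`stub_negativeMemoryMoment`), by name. -/
def stub_negativeMemoryMoment : Prop := type_of% Birth.stub_negativeMemoryMoment

end Registered

/-- **Skeleton theorem (kernel-checked, no `sorry`): the two stubs give the crux
`CageBudgetFekete.QuasiSuperadditiveHeatVariance` BY NAME.**  Cage budget `K := 2 · max K₀ 0`; for `s, t ≥ 0` the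
window bound (stub W at `C := C_T`) plus the moment bound (stub M at `R := s + t`). [folklore] -/
theorem QuasiSuperadditiveHeatVariance_of (hW : Registered.stub_windowCovarianceBound)
    (hM : Registered.stub_negativeMemoryMoment) :
    _root_.Summit.AtomisticToContinuum.FouriersLaw.Theses.CageBudgetFekete.QuasiSuperadditiveHeatVariance := by
  intro ω₂ lam β γ hω hl hβ T hT μ hG hSI hRefl D hP hShift hAC hC V hV
  obtain ⟨K₀, hK₀⟩ := hM ω₂ lam β γ hω hl hβ T hT μ hG hSI hRefl D hP hShift hAC hC
  refine ⟨2 * max K₀ 0, by positivity, fun s t hs ht => ?_⟩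
  have h1 : V s + V t ≤ V (s + t) +
      2 * ∫ w in Set.Ioc (0:ℝ) (s + t), w * max (-(D.currentCorrelation μ w)) 0 :=
    hW (fun w => D.currentCorrelation μ w) hC V hV s t hs ht
  have h2 : ∫ w in Set.Ioc (0:ℝ) (s + t), w * max (-(D.currentCorrelation μ w)) 0 ≤ K₀ :=
    hK₀ (s + t) (add_nonneg hs ht)
  have h3 : K₀ ≤ max K₀ 0 := le_max_left _ _
  linarith

/-- The registered stubs instantiate the skeleton theorem: the crux BY NAME, its only `sorry`s being those of
`stub_windowCovarianceBound` and `stub_negativeMemoryMoment`. [folklore] -/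
theorem QuasiSuperadditiveHeatVariance_of_stubs :
    _root_.Summit.AtomisticToContinuum.FouriersLaw.Theses.CageBudgetFekete.QuasiSuperadditiveHeatVariance :=
  QuasiSuperadditiveHeatVariance_of stub_windowCovarianceBound stub_negativeMemoryMoment

end Summit.AtomisticToContinuum.FouriersLaw.Cruxes.QuasiSuperadditiveHeatVariance.Birth
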